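import Summits.CriticalPhenomena.PercolationContinuityZ3.Theses.PercNonProliferation
import Literature.Probability.Percolation.SiteConnectionTools
import HarnessLib

/-!
# Crux `PercNonProliferation.NonProliferation` (stmt-CriticalPhenomena-4444), line `boundary-pinning` — stub `stub_boundaryGrid`

Helper file for the lead's skeleton of line `boundary-pinning` (payload slug `Sketch`,
prover-line-stmt-CriticalPhenomena-4444-c1). Proves exactly the registered stub signature
`stub_boundaryGrid`; lands with `--supports stmt-CriticalPhenomena-4444`.

Pure lattice geometry, no probability: for every `d`, `R` and cell side `s ≥ 1` the inner vertex
boundary `B := ∂ⁱⁿΛ_R` of the box `Λ_R = {-R, …, R}^d ⊆ ℤ^d` is covered by the traces on `B` of the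
grid cubes `∏_i [z_i s, (z_i + 1) s)`. Concretely, with the cell index `y ↦ (i ↦ ⌊y_i / s⌋)`
(Lean's `Int` division by `s > 0` is floor division) the cells are the fibres
`{x ∈ B | idx x = z}` over `z ∈ idx '' B`:

* each cell is a subset of `B` (`Finset.filter_subset`) and every `y ∈ B` lies in its own cell;
* two points with the same index differ by `< s` in every coordinate
  (`StubBoundaryGrid.abs_sub_add_one_le_of_ediv_eq`);
* a cell lies in the cube `∏_i [z_i s, z_i s + s)` of cardinality `s^d`
  (`StubBoundaryGrid.card_filter_ediv_eq_le`);
* a point of `B` lies on a face `{x_i = ±R}` (`exists_eq_of_mem_innerBoundary_box`), so its index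
  has `i`-th coordinate `⌊±R/s⌋` and the other `d - 1` coordinates in
  `[-⌊R/s⌋ - 1, ⌊R/s⌋]`, whence at most `2d (2⌊R/s⌋ + 2)^{d-1} ≤ 2d (2R/s + 2)^{d-1}` indices
  (`StubBoundaryGrid.card_image_ediv_le`, counting faces as in `card_filter_box_apply_eq_le`).
-/

noncomputable section

namespace Summit.CriticalPhenomena.PercolationContinuityZ3.Theorems.NonProliferation

open MeasureTheory Filter Topology
open Literature.Probability.LatticeModels Literature.Probability.Percolation

namespace StubBoundaryGrid

/-- Two integers with the same floor quotient by `s > 0` differ by less than `s`. -/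
theorem abs_sub_add_one_le_of_ediv_eq {s a b : ℤ} (hs : 0 < s) (h : a / s = b / s) :
    |a - b| + 1 ≤ s := by
  have ha := Int.ediv_mul_add_emod a s
  have hb := Int.ediv_mul_add_emod b s
  have ha0 := Int.emod_nonneg a hs.ne'
  have hb0 := Int.emod_nonneg b hs.ne'
  have ha1 := Int.emod_lt_of_pos a hs
  have hb1 := Int.emod_lt_of_pos b hs
  rw [h] at ha
  have hab : |a - b| < s := abs_sub_lt_iff.2 ⟨by linarith, by linarith⟩
  omega

/-- A fibre of the cell index `x ↦ (i ↦ ⌊x_i / s⌋)` lies in a grid cube `∏_i [z_i s, z_i s + s)`,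
so it has at most `s ^ d` points. -/
theorem card_filter_ediv_eq_le {d s : ℕ} (hs : 1 ≤ s) (A : Finset (Site d)) (z : Site d) :
    (A.filter fun x => (fun i => x i / (s : ℤ)) = z).card ≤ s ^ d := by
  classical
  have hs0 : (0 : ℤ) < s := by omega
  calc (A.filter fun x => (fun i => x i / (s : ℤ)) = z).card
      ≤ (Fintype.piFinset fun i => Finset.Ico (z i * s) (z i * s + s)).card := by
        refine Finset.card_le_card fun x hx => ?_
        rw [Finset.mem_filter] at hx
        rw [Fintype.mem_piFinset]
        intro i
        have hi : x i / (s : ℤ) = z i := congr_fun hx.2 i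
        have h1 := Int.ediv_mul_add_emod (x i) s
        have h2 := Int.emod_nonneg (x i) hs0.ne'
        have h3 := Int.emod_lt_of_pos (x i) hs0
        rw [hi] at h1
        rw [Finset.mem_Ico]
        constructor <;> linarith
    _ = s ^ d := by
        rw [Fintype.card_piFinset]
        simp only [Int.card_Ico, add_sub_cancel_left, Int.toNat_natCast, Finset.prod_const,
          Finset.card_univ, Fintype.card_fin]

/-- A "face slab" of indices: `i`-th coordinate pinned to `c`, the other `d - 1` coordinates in
`[-M - 1, M]`; it has exactly `(2M + 2)^{d-1}` elements (cf. `card_filter_box_apply_eq_le`). -/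
theorem card_piFinset_face {d : ℕ} (i : Fin d) (c : ℤ) (M : ℕ) :
    (Fintype.piFinset fun j => if j = i then ({c} : Finset ℤ)
      else Finset.Icc (-(M : ℤ) - 1) (M : ℤ)).card = (2 * M + 2) ^ (d - 1) := by
  classical
  rw [Fintype.card_piFinset]
  simp only [apply_ite Finset.card, Finset.card_singleton, Int.card_Icc]
  rw [Finset.prod_ite, Finset.prod_const_one, one_mul, Finset.prod_const,
    Finset.filter_ne' Finset.univ i, Finset.card_erase_of_mem (Finset.mem_univ i),
    Finset.card_univ, Fintype.card_fin]
  congr 1; omega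

/-- The cell index `y ↦ (i ↦ ⌊y_i / s⌋)` takes at most `2d (2⌊R/s⌋ + 2)^{d-1}` values on the inner
vertex boundary of `Λ_R`: a boundary point lies on a face `{y_i = ±R}`, so the `i`-th index is
`⌊±R/s⌋` and the remaining `d - 1` indices lie in `[-⌊R/s⌋ - 1, ⌊R/s⌋]`. -/
theorem card_image_ediv_le {d : ℕ} (R : ℕ) {s : ℕ} (hs : 1 ≤ s) :
    ((innerBoundary (zdGraph d) (box d R)).image fun (y : Site d) (i : Fin d) => y i / (s : ℤ)).card
      ≤ 2 * d * (2 * (R / s) + 2) ^ (d - 1) := by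
  classical
  have hs0 : (0 : ℤ) < s := by omega
  have hM : ((R / s : ℕ) : ℤ) = (R : ℤ) / (s : ℤ) := Int.natCast_ediv R s
  have hsub : ((innerBoundary (zdGraph d) (box d R)).image
      fun (y : Site d) (i : Fin d) => y i / (s : ℤ)) ⊆
      Finset.univ.biUnion fun i : Fin d =>
        (Fintype.piFinset fun j => if j = i then ({(R : ℤ) / s} : Finset ℤ)
          else Finset.Icc (-((R / s : ℕ) : ℤ) - 1) ((R / s : ℕ) : ℤ)) ∪
        (Fintype.piFinset fun j => if j = i then ({(-(R : ℤ)) / s} : Finset ℤ)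
          else Finset.Icc (-((R / s : ℕ) : ℤ) - 1) ((R / s : ℕ) : ℤ)) := by
    intro z hz
    obtain ⟨y, hy, rfl⟩ := Finset.mem_image.1 hz
    have hybox : y ∈ box d R := (mem_innerBoundary_iff.1 hy).1
    rw [mem_box] at hybox
    obtain ⟨i, hi⟩ := exists_eq_of_mem_innerBoundary_box hy
    have hR : (R : ℤ) < ((R : ℤ) / s + 1) * s := Int.lt_ediv_add_one_mul_self _ hs0
    have hother : ∀ j, y j / (s : ℤ) ∈ Finset.Icc (-((R / s : ℕ) : ℤ) - 1) ((R / s : ℕ) : ℤ) := by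
      intro j
      rw [Finset.mem_Icc, hM]
      refine ⟨(Int.le_ediv_iff_mul_le hs0).2 ?_, Int.ediv_le_ediv hs0 (hybox j).2⟩
      have hyj := (hybox j).1
      linarith
    simp only [Finset.mem_biUnion, Finset.mem_univ, true_and, Finset.mem_union,
      Fintype.mem_piFinset]
    refine ⟨i, ?_⟩
    rcases hi with hi | hi
    · refine Or.inl fun j => ?_
      split_ifs with hj
      · subst hj; simp [hi]
      · exact hother j
    · refine Or.inr fun j => ?_
      split_ifs with hj
      · subst hj; simp [hi]
      · exact hother j
  calc ((innerBoundary (zdGraph d) (box d R)).image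
        fun (y : Site d) (i : Fin d) => y i / (s : ℤ)).card
      ≤ _ := Finset.card_le_card hsub
    _ ≤ ∑ i : Fin d, ((Fintype.piFinset fun j => if j = i then ({(R : ℤ) / s} : Finset ℤ)
          else Finset.Icc (-((R / s : ℕ) : ℤ) - 1) ((R / s : ℕ) : ℤ)) ∪
        (Fintype.piFinset fun j => if j = i then ({(-(R : ℤ)) / s} : Finset ℤ)
          else Finset.Icc (-((R / s : ℕ) : ℤ) - 1) ((R / s : ℕ) : ℤ))).card :=
        Finset.card_biUnion_le
    _ ≤ ∑ _i : Fin d, 2 * (2 * (R / s) + 2) ^ (d - 1) := by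
        refine Finset.sum_le_sum fun i _ => (Finset.card_union_le _ _).trans ?_
        rw [card_piFinset_face, card_piFinset_face]
        omega
    _ = 2 * d * (2 * (R / s) + 2) ^ (d - 1) := by
        rw [Finset.sum_const, Finset.card_univ, Fintype.card_fin, smul_eq_mul]
        ring

/-- The real-number form of the index count: `2⌊R/s⌋ + 2 ≤ 2R/s + 2`, hence
`2d (2⌊R/s⌋ + 2)^{d-1} ≤ 2d (2R/s + 2)^{d-1}`. -/
theorem cast_count_le (d R s : ℕ) :
    ((2 * d * (2 * (R / s) + 2) ^ (d - 1) : ℕ) : ℝ) ≤ 2 * d * (2 * (R : ℝ) / s + 2) ^ (d - 1) := by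
  have h1 : ((R / s : ℕ) : ℝ) ≤ (R : ℝ) / s := Nat.cast_div_le
  push_cast
  gcongr
  rw [mul_div_assoc]
  linarith

end StubBoundaryGrid

/-- **Stub `stub_boundaryGrid`** of line `boundary-pinning` (crux stmt-CriticalPhenomena-4444): for every
`d`, `R` and cell side `s ≥ 1`, the inner vertex boundary `∂ⁱⁿΛ_R` of the box `Λ_R ⊆ ℤ^d` is covered
by a family `𝒬` of at most `2d (2R/s + 2)^{d-1}` cells, each a subset of `∂ⁱⁿΛ_R` of
coordinate-diameter `< s` (i.e. `|u_i - v_i| + 1 ≤ s`) and of cardinality `≤ s^d`. The cells are the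
nonempty traces on `∂ⁱⁿΛ_R` of the grid cubes `∏_i [z_i s, (z_i + 1) s)`, i.e. the fibres of the cell
index `y ↦ (i ↦ ⌊y_i / s⌋)`; a cube meeting the face `{x_i = ±R}` has `z_i = ⌊±R/s⌋` and its other
`d - 1` indices in `[-⌊R/s⌋ - 1, ⌊R/s⌋]`. -/
theorem stub_boundaryGrid :
    ∀ (d R s : ℕ), 1 ≤ s →
      ∃ 𝒬 : Finset (Finset (Site d)),
        (∀ Q ∈ 𝒬, Q ⊆ innerBoundary (zdGraph d) (box d R)) ∧
        (∀ Q ∈ 𝒬, ∀ u ∈ Q, ∀ v ∈ Q, ∀ i : Fin d, |u i - v i| + 1 ≤ (s : ℤ)) ∧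
        (∀ Q ∈ 𝒬, Q.card ≤ s ^ d) ∧
        (∀ y ∈ innerBoundary (zdGraph d) (box d R), ∃ Q ∈ 𝒬, y ∈ Q) ∧
        ((𝒬.card : ℝ) ≤ 2 * d * (2 * (R : ℝ) / s + 2) ^ (d - 1)) := by
  intro d R s hs
  have hs0 : (0 : ℤ) < s := by omega
  refine ⟨((innerBoundary (zdGraph d) (box d R)).image
      fun (y : Site d) (i : Fin d) => y i / (s : ℤ)).image
      fun z => (innerBoundary (zdGraph d) (box d R)).filter fun x => (fun i => x i / (s : ℤ)) = z,
    ?_, ?_, ?_, ?_, ?_⟩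
  · intro Q hQ
    obtain ⟨z, -, rfl⟩ := Finset.mem_image.1 hQ
    exact Finset.filter_subset _ _
  · intro Q hQ u hu v hv i
    obtain ⟨z, -, rfl⟩ := Finset.mem_image.1 hQ
    have hu' := congr_fun (Finset.mem_filter.1 hu).2 i
    have hv' := congr_fun (Finset.mem_filter.1 hv).2 i
    exact StubBoundaryGrid.abs_sub_add_one_le_of_ediv_eq hs0 (hu'.trans hv'.symm)
  · intro Q hQ
    obtain ⟨z, -, rfl⟩ := Finset.mem_image.1 hQ
    exact StubBoundaryGrid.card_filter_ediv_eq_le hs _ z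
  · intro y hy
    refine ⟨(innerBoundary (zdGraph d) (box d R)).filter
        fun x => (fun i => x i / (s : ℤ)) = fun i => y i / (s : ℤ), ?_, ?_⟩
    · exact Finset.mem_image.2 ⟨_, Finset.mem_image_of_mem _ hy, rfl⟩
    · exact Finset.mem_filter.2 ⟨hy, rfl⟩
  · calc ((((innerBoundary (zdGraph d) (box d R)).image
            fun (y : Site d) (i : Fin d) => y i / (s : ℤ)).image
            fun z => (innerBoundary (zdGraph d) (box d R)).filter
              fun x => (fun i => x i / (s : ℤ)) = z).card : ℝ)
        ≤ ((innerBoundary (zdGraph d) (box d R)).image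
            fun (y : Site d) (i : Fin d) => y i / (s : ℤ)).card := by
          exact_mod_cast Finset.card_image_le
      _ ≤ ((2 * d * (2 * (R / s) + 2) ^ (d - 1) : ℕ) : ℝ) := by
          exact_mod_cast StubBoundaryGrid.card_image_ediv_le R hs
      _ ≤ 2 * d * (2 * (R : ℝ) / s + 2) ^ (d - 1) := StubBoundaryGrid.cast_count_le d R s

end Summit.CriticalPhenomena.PercolationContinuityZ3.Theorems.NonProliferation

end
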